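import Summits.RiemannHypothesis.RiemannHypothesis.Theorems.TiltedLandingLaw421R3Lens1CoverageC
import Summits.RiemannHypothesis.RiemannHypothesis.Theorems.TiltedLandingLaw421R3Lens1OneBodyU

/-! # Lens-1 COVERAGE THEOREM (file D: the ISOLATION sub-cell «E-iso» of cell E and the v4 compositions; (CA453) accepted, (CA455) pointwise, (CA462)(2) free centre, (CA470)(ii) free model constant)

E-side analogue of file C (cadence rule (CA449)(5): one registry bump per PROVED lemma shrinking an open stub).
Imports file C (`…R3Lens1CoverageC`) and the one-body U lemmas (`…R3Lens1OneBodyU` v3: `RhW08.Lens1OneBody.clusterNumbersU_of_isolated_center`).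
Declares the cell datum `IsolatedNewton` (v4, FREE CENTRE AND FREE MODEL CONSTANT: an isolated simple zero `v` of `f^{(j)}`, a disc `D(c, ρ)`,
`‖v − c‖ < ρ ≤ Im c`, inside the column, excluding every other zero of `f^{(j)}`, and a witness `K : ℂ` whose model `1 + K(z − v)` has its zero
`v − K⁻¹` in the disc and dominates the variation of the log-derivative of the cofactor POINTWISE on the circle; `newtonK f j v` is the documented
prediction for `K` — census K-C6b: free `(c, ρ, K)` certifies 52/52 column-feasible E rows of TABLE S), `isolatedNewton_of_center_v`
(the v2 datum centred at `v` with `K = newtonK f j v` is a special case), `doorU_of_isolatedNewton` / `regime_Eiso` (PROVED: door U with `S = {v}`, hence a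
successor), the open residual stub `RegEres8` (cell E WITHOUT an isolation certificate ⇒ a Q8 door; strictly below `RegE8`; NAME and binder
shape unchanged from v2, so DRAFT-5/6b stand), and the compositions `antiEscapeCore_of_regimes4` / `restSuccBotQ_of_regimes4` /
`TiltedLandingLaw421R_of_regimes4 : RegCov8 → RegLfar8 → RegEres8 → RateLawsHalfQ → crux`.
0 sorry.  Nothing here bears on the truth of RH; RH is not proved; the crux ⟨33346⟩ stays OPEN. -/

namespace RhW08.Lens1Coverage

set_option linter.dupNamespace false

open Complex Set
open scoped ComplexConjugate
open Literature.Analysis.Complex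
open Summit.RiemannHypothesis.RiemannHypothesis.Theorems.Splittings.JensenWindow
open RhIdea6.G17.W07C7 RhIdea6.G17.W07C7.Rev6 RhIdea6.G18.W07C8.Law421BirthS RhIdea6.G19.W07C11.Seam
open RhIdea6.G20.W07C12.Frac RhIdea6.G20.W07C12.StColP RhW07.C12.FieldSplit RhIdea6.G21.W07C13.TentMax
open RhW07.C14.TwoSided RhW07.C14.Classes RhW07.C14.Lineage RhW07.C14.Booking
open RhW07.C13.Heredity RhIdea6.G22.W07C15pre.Injection RhW07.E3.Cell RhW07.E3.Lit
open RhW08.Round1 RhW08.StSwap RhW08.Round2 RhW08.QuadW RhW08.SealSwapQ RhW08.SealSwap RhW08.SuccB RhW08.SuccSplit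
open RhW08.SuccTheft RhW08.Column RhW08.Hurwitz RhW08.ClusterQ RhW08.ClusterQM RhW08.NewtonDoor RhW08.NewtonDoorGenusOne RhW08.PurseP
open RhW08.AntiEscapeSplit7

/-! ## §18 The isolation sub-cell «E-iso» -/

/-- CELL DATUM «E-iso» (ISOLATION CERTIFICATE at `v`, level `j`; v4 = FREE CENTRE (CA462)(2) AND FREE MODEL CONSTANT (CA470)(ii)): a disc
`D(c, ρ)` with `0 < ρ`, `‖v − c‖ < ρ ≤ Im c` (upper half-plane), `|Re c − x₀| + ρ ≤ R/2` (column), every OTHER zero of `f^{(j)}` strictly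
outside `D̄(c, ρ)`, and a witness `K : ℂ` with a zero of the model `1 + K·(z − v)` inside the open disc (the point `v − K⁻¹`; the documented
prediction is `K = newtonK f j v`, the Newton child) such that on the circle `‖z − c‖ = ρ` the variation of the log-derivative of the cofactor
`h := dslope f^{(j)} v` is dominated POINTWISE by the model: `‖z − v‖·‖h′/h (z) − K‖ < ‖1 + K·(z − v)‖` (= the hypotheses of
`RhW08.Lens1OneBody.clusterNumbersU_of_isolated_center`, letter for letter). -/
def IsolatedNewton (f : ℂ → ℂ) (x₀ R : ℝ) (j : ℕ) (v : ℂ) : Prop :=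
  ∃ (c : ℂ) (ρ : ℝ) (K : ℂ), 0 < ρ ∧ ‖v - c‖ < ρ ∧ ρ ≤ c.im ∧ |c.re - x₀| + ρ ≤ R / 2 ∧
    (∀ z : ℂ, iteratedDeriv j f z = 0 → z ≠ v → ρ < ‖z - c‖) ∧
    (∃ z₀ : ℂ, ‖z₀ - c‖ < ρ ∧ 1 + K * (z₀ - v) = 0) ∧
    ∀ z : ℂ, ‖z - c‖ = ρ →
      ‖z - v‖ * ‖deriv (dslope (iteratedDeriv j f) v) z / dslope (iteratedDeriv j f) v z - K‖ < ‖1 + K * (z - v)‖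

/-- The v2 datum (disc CENTRED AT `v`, strong field `1 < ‖K‖·ρ`, clause `ρ·‖h′/h − K‖ < ‖1 + K(z − v)‖`) is the special case `c = v` of
the v4 datum (`K := newtonK f j v`, model zero := the Newton child `v − K⁻¹`, `‖K⁻¹‖ < ρ`). -/
theorem isolatedNewton_of_center_v {f : ℂ → ℂ} {x₀ R : ℝ} {j : ℕ} {v : ℂ} {ρ : ℝ} (hρ : 0 < ρ) (hρv : ρ ≤ v.im)
    (hcol : |v.re - x₀| + ρ ≤ R / 2) (hiso : ∀ z : ℂ, iteratedDeriv j f z = 0 → z ≠ v → ρ < ‖z - v‖)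
    (hK : 1 < ‖newtonK f j v‖ * ρ)
    (hvar : ∀ z : ℂ, ‖z - v‖ = ρ →
      ρ * ‖deriv (dslope (iteratedDeriv j f) v) z / dslope (iteratedDeriv j f) v z - newtonK f j v‖ < ‖1 + newtonK f j v * (z - v)‖) :
    IsolatedNewton f x₀ R j v := by
  have hKpos : 0 < ‖newtonK f j v‖ := by
    by_contra h0
    push Not at h0
    have : ‖newtonK f j v‖ * ρ ≤ 0 := mul_nonpos_of_nonpos_of_nonneg h0 hρ.le
    linarith
  have hK0 : newtonK f j v ≠ 0 := norm_pos_iff.1 hKpos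
  have hKinv : ‖(newtonK f j v)⁻¹‖ < ρ := by
    rw [norm_inv, inv_lt_comm₀ hKpos hρ]
    calc ρ⁻¹ = ρ⁻¹ * 1 := (mul_one _).symm
      _ < ρ⁻¹ * (‖newtonK f j v‖ * ρ) := mul_lt_mul_of_pos_left hK (inv_pos.2 hρ)
      _ = ‖newtonK f j v‖ := by field_simp
  refine ⟨v, ρ, newtonK f j v, hρ, by rw [sub_self, norm_zero]; exact hρ, hρv, hcol, hiso,
    ⟨v - (newtonK f j v)⁻¹, by simpa using hKinv, ?_⟩, ?_⟩
  · field_simp; ring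
  · intro z hz
    rw [hz]; exact hvar z hz

/-- ★ Door U (with `S = {v}`, centre `c`, model constant `K`) from an isolation certificate at a simple zero (PROVED:
`RhW08.Lens1OneBody.clusterNumbersU_of_isolated_center`). -/
theorem doorU_of_isolatedNewton {f : ℂ → ℂ} (hf : Differentiable ℂ f) {x₀ R : ℝ} {j : ℕ} {v : ℂ}
    (hv : iteratedDeriv j f v = 0) (hv1 : iteratedDeriv (j + 1) f v ≠ 0) (h : IsolatedNewton f x₀ R j v) :
    ClusterNumbersU f x₀ R j := by
  obtain ⟨c, ρ, K, hρ, hvc, hρc, hcol, hiso, hMz, hvar⟩ := h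
  exact RhW08.Lens1OneBody.clusterNumbersU_of_isolated_center hf hv hv1 hρ hvc hρc hcol hiso hMz hvar

/-- ★ REGIME LEMMA «E-iso» (PROVED, successor currency): frame + a state `v` at level `j` with `f^{(j+1)} v ≠ 0` and an isolation
certificate ⇒ a successor at level `j+1` (door U, `RhW08.AntiEscapeSplit7.succ_of_clusterNumbersU`). -/
theorem regime_Eiso {η : ℝ} {f : ℂ → ℂ} {x₀ s hmax R Hs : ℝ} {B j : ℕ} {v : ℂ}
    (hE : EngineHyps5 2 η f x₀ s hmax R Hs B) (hst : StTrkDQ η f x₀ s hmax R Hs B j v) (hv1 : iteratedDeriv (j + 1) f v ≠ 0)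
    (h : IsolatedNewton f x₀ R j v) : ∃ u : ℂ, StTrkDQ η f x₀ s hmax R Hs B (j + 1) u :=
  succ_of_clusterNumbersU hE hst (doorU_of_isolatedNewton hE.1 hst.2.1 hv1 h)

/-! ## §19 The residual stub «E-res» and the v4 compositions -/

/-- (v4) OPEN REGIME «E-res» in Q8-door currency: cell E WITHOUT an isolation certificate ⇒ a door.  Strictly weaker than `RegE8`
(`regEres8_of_regE8`).  Content (census K-C6, TABLE S): the E rows at levels `j ≥ 1` whose state `v` sits at a column EDGE (column room
`R/2 − |Re v − x₀| < 1/‖K‖`, so no column disc holds the Newton child) — the lateral-window form `RhW08.Lens1OneBody.succ_of_isolated_pt`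
and the real-centred door `ClusterNumbersJ'` are their owner candidates. -/
def RegEres8 : Prop :=
  ∀ (η : ℝ) (f : ℂ → ℂ) (x₀ s hmax R Hs : ℝ) (B : ℕ), EngineHyps5 2 η f x₀ s hmax R Hs B → ∀ (j : ℕ) (v : ℂ),
    IsLowest StTrkDQ η f x₀ s hmax R Hs B j v → ¬ ReadyR2 η f x₀ s hmax R Hs B j v →
    ¬ AllInBandInRangeWindow f x₀ R Hs j v → ¬ Dimple f j v → DiscOverlap f j v →
    iteratedDeriv (j + 1) f v ≠ 0 → CellE f x₀ R Hs j v → ¬ IsolatedNewton f x₀ R j v → Doors8 f x₀ R Hs j v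

/-- Monotonicity: the cell-E stub implies the E-res stub. -/
theorem regEres8_of_regE8 (hX : RegE8) : RegEres8 :=
  fun η f x₀ s hmax R Hs B hE j v hlow hnR hwin hdim hov hz hc _ =>
    hX η f x₀ s hmax R Hs B hE j v hlow hnR hwin hdim hov hz hc

/-- Monotonicity: the SUCC law of record implies the residual stub. -/
theorem regEres8_of_doorAvailLawQ8 (hL8 : RhW08.LandingDoor.DoorAvailLawQ8) : RegEres8 :=
  regEres8_of_regE8 (doorAvailLawQ8_implies_regimes hL8).2.2.2.2

/-- ★ (v4) `AntiEscapeCore` from `RegCov8`, `RegLfar8`, `RegEres8`: cells F, N♭, L-deep, L-Q, E-iso are discharged by PROVED regime lemmas. -/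
theorem antiEscapeCore_of_regimes4 (hRB : RealCritBoundNSig) (hC : RegCov8) (hL : RegLfar8) (hX : RegEres8) : AntiEscapeCore := by
  intro η f x₀ s hmax R Hs B hE j v hlow hnR hwin hdim hov
  by_cases hz : iteratedDeriv (j + 1) f v = 0
  · exact succ_of_multiple hE hlow.1 hz
  rcases cells_cover f x₀ R Hs j v with h | h | h | h | h
  · exact succ_of_doors8 hRB hE hlow hnR
      (hC η f x₀ s hmax R Hs B hE j v hlow hnR hwin hdim hov hz h (exists_cover_of_coverIndex_pos_frame hE hlow.1 hz h))
  · exact regime_F hE hlow.1 h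
  · exact regime_Nb hE hlow.1 h
  · by_cases hdeep : LandingDipDeep f x₀ R Hs j v
    · exact regime_Ldeep hE hdeep
    · by_cases hq : LandingDipQ f x₀ R Hs j v
      · exact regime_LQ hE hq
      · exact succ_of_doors8 hRB hE hlow hnR (hL η f x₀ s hmax R Hs B hE j v hlow hnR hwin hdim hov hz h hdeep hq)
  · by_cases hiso : IsolatedNewton f x₀ R j v
    · exact regime_Eiso hE hlow.1 hz hiso
    · exact succ_of_doors8 hRB hE hlow hnR (hX η f x₀ s hmax R Hs B hE j v hlow hnR hwin hdim hov hz h hiso)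

/-- `RestSuccBotQ` from `RegCov8`, `RegLfar8`, `RegEres8`, via `antiEscapeCore_of_regimes4`. -/
theorem restSuccBotQ_of_regimes4 (hRB : RealCritBoundNSig) (hC : RegCov8) (hL : RegLfar8) (hX : RegEres8) : RestSuccBotQ :=
  restSuccBotQ_of_pieces dimpleSig_holds (antiEscape_of_core (antiEscapeCore_of_regimes4 hRB hC hL hX))

/-- ★★ (v4) THE CRUX BY NAME from `RegCov8`, `RegLfar8`, `RegEres8` and lens-2's rate law. -/
theorem TiltedLandingLaw421R_of_regimes4 (hC : RegCov8) (hL : RegLfar8) (hX : RegEres8) (hR : RhW08.RateSplit.RateLawsHalfQ) :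
    Summit.RiemannHypothesis.RiemannHypothesis.Theses.EarlyAppointments.TiltedLandingLaw421R :=
  law421Half_of_succ_rate (restSuccBotQ_of_regimes4 RhW08.ClusterQM.realCritBoundNSig_holds hC hL hX)
    (RhW08.RateSplit.restRateBotPQ_half_of_rateLaws hR)

/-- Sanity (v3 ⇒ v4): file C's hypotheses still close the crux through this file. -/
theorem TiltedLandingLaw421R_of_regimes3' (hC : RegCov8) (hL : RegLfar8) (hX : RegE8) (hR : RhW08.RateSplit.RateLawsHalfQ) :
    Summit.RiemannHypothesis.RiemannHypothesis.Theses.EarlyAppointments.TiltedLandingLaw421R :=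
  TiltedLandingLaw421R_of_regimes4 hC hL (regEres8_of_regE8 hX) hR

end RhW08.Lens1Coverage
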